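import Summits.CriticalPhenomena.SAWScalingLimit.Theses.SAWMassiveIsingTilt
import Summits.CriticalPhenomena.SAWScalingLimit.Theses.SAWResidueField
import Summits.CriticalPhenomena.SAWScalingLimit.Theses.SAWBetheAnsatz
import Summits.CriticalPhenomena.SAWScalingLimit.Theses.SAWLatticeVirasoro
import Summits.CriticalPhenomena.SAWScalingLimit.Theses.SAWTiltedExplorer
import Summits.CriticalPhenomena.SAWScalingLimit.Theses.SAWTurnDefect
import Summits.CriticalPhenomena.SAWScalingLimit.Theses.SAWTrackTransport
import Summits.CriticalPhenomena.SAWScalingLimit.Theorems.SAWDevelopingMapHexTransferCompassEndpoints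
import Summits.CriticalPhenomena.SAWScalingLimit.Theorems.SAWDevelopingMapHexTransferAngleTransportOfTrackTransport

/-!
# Line `relay3` for the crux `LatticeUniversality` (stmt-CriticalPhenomena-0807) — the Yang–Baxter
# relay re-cut in ∃-form: three stubs, each implied by the stubs of the registered line `birth`

ALTERNATIVE / RESHAPED LINE published by the crux-strategist seat `cstrat-stmt-CriticalPhenomena-0807-s1`
(STRATEGY-CENSUS.md §Decomposition d3). It is NOT skeleton-registered (the live skeleton stays
`Lines/birth.lean`; a lead who adopts this cut runs `ledger skeleton check …/Lines/relay3.lean --crux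
stmt-CriticalPhenomena-0807`). Same mechanism as `birth` (Glazman–Manolescu's Yang–Baxter family with
the hexagonal lattice as the reference `H(π/3)`; GM19 arXiv:1708.00395 p. 4 and §4; DKKMO
arXiv:2012.11672 Thm 2.1 at `n = 0`), re-cut so that every intermediate Glazman–Manolescu endpoint
approximation is CHOSEN by the prover (∃-forms) instead of quantified universally:

* `stub_hexToThirdYB` (XL; the (A)-free research stub): for every hexagonal endpoint approximation of
  `D` (crux conventions, any admissible depth) THERE IS a `π/3` mid-edge endpoint approximation whose
  critical GM law is asymptotically the hexagonal law. Replaces `birth`'s `stub_thirdEndpoints ∧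
  stub_hexThirdConventions` (∀∀-form) by a strictly weaker statement: the prover picks the mid-edges
  (e.g. adjacent to the given vertices, or boundary mid-edges where the exact dictionary
  `yb-relay v4 stub_gmHexDictionary` applies), so the residual content is exactly the (A)-free
  robustness kernel — faces-vs-vertices boundary layer, half-period shift, first-step / start
  relocation — and nothing about arbitrary pairings.
* `stub_thirdToSquareYB` (open-problem; HARDEST): for every `π/3` endpoint approximation THERE IS a
  square-tiling one with asymptotically the same critical GM law — law-level transport inside the
  family; implied by `birth`'s `stub_angleTransport` (∀∀) and hence by
  `SAWTrackTransport.YBLimitExists ∧ AngleUniversality` (landed `angleTransport_of_trackTransport`,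
  recorded below as `stub_thirdToSquareYB_of_trackTransport`, sorry-free).
* `stub_ybToUniform` = `SAWTrackTransport.YBtoUniform` (item stmt-CriticalPhenomena-16966) verbatim.

Composition `LatticeUniversality_of_stubs` (sorry-free; identical to the split glue
`Cruxes/LatticeUniversality/Split.lean`) and `LatticeUniversality_of : SAWMassiveIsingTilt.LatticeUniversality`
concluding the crux BY NAME (+ the five sibling copies that still carry the decl). The three stub statements are, verbatim, the
children `HexToThirdYB / ThirdToSquareYB / YBtoUniform` of the prepared route-level split
(folder `children.json`; filing deferred by the gate to the seat's final cycle).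
-/

noncomputable section

namespace Summit.CriticalPhenomena.SAWScalingLimit.Cruxes.LatticeUniversality.Relay3

open MeasureTheory Filter Topology Set
open scoped NNReal ENNReal BoundedContinuousFunction
open Literature.Probability.RandomPlanarGeometry
open Literature.Probability.RandomPlanarGeometry.SAW
open Literature.Probability.RandomPlanarGeometry.SAW.YangBaxter
open Literature.Probability.LatticeModels (Site HexVertex hexGraph hexCenter)
open Summit.CriticalPhenomena.SAWScalingLimit.Theses

/-! ### The stub statements -/

/-- Child / stub 1 (**convention bridge at the hexagonal end, ∃-form**). [cite: GlazmanManolescu2019, p. 4 (θ = π/3 is the regular hexagonal SAW)] -/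
def HexToThirdYB : Prop :=
  ∀ (D : DobrushinDomain) (a b : ℝ → HexVertex),
    SAW.IsEmbEndpointApprox hexGraph hexCenter D a b →
    ∃ a' b' : ℝ → MidEdge, IsYBEndpointApprox (fun (_ : ℤ) => Real.pi / 3) D a' b' ∧
      ∀ f : BoundedContinuousFunction (CurveClass ℂ) ℝ,
        Tendsto (fun δ : ℝ => (∫ γ, f γ.curve ∂(SAW.hexSAWLaw D.carrier δ (a δ) (b δ))) -
            ∫ γ, f (γ.curve (fun (_ : ℤ) => Real.pi / 3) δ)
              ∂(ybLaw (fun (_ : ℤ) => Real.pi / 3) D.carrier δ 1 (a' δ) (b' δ)))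
          (𝓝[>] (0 : ℝ)) (𝓝 0)

/-- Child / stub 2 (**law-level Yang–Baxter transport inside the family, π/3 → π/2, ∃-form**; hardest).
[cite: GlazmanManolescu2019, §4] [cite: DKKMO2020Rotational, Theorem 2.1] -/
def ThirdToSquareYB : Prop :=
  ∀ (D : DobrushinDomain) (a b : ℝ → MidEdge),
    IsYBEndpointApprox (fun (_ : ℤ) => Real.pi / 3) D a b →
    ∃ a' b' : ℝ → MidEdge, IsYBEndpointApprox (fun (_ : ℤ) => Real.pi / 2) D a' b' ∧
      ∀ f : BoundedContinuousFunction (CurveClass ℂ) ℝ,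
        Tendsto (fun δ : ℝ =>
            (∫ γ, f (γ.curve (fun (_ : ℤ) => Real.pi / 3) δ)
                ∂(ybLaw (fun (_ : ℤ) => Real.pi / 3) D.carrier δ 1 (a δ) (b δ))) -
              ∫ γ, f (γ.curve (fun (_ : ℤ) => Real.pi / 2) δ)
                ∂(ybLaw (fun (_ : ℤ) => Real.pi / 2) D.carrier δ 1 (a' δ) (b' δ)))
          (𝓝[>] (0 : ℝ)) (𝓝 0)

/-! ### Registered stubs (the ONLY sorries of this file) -/

/-- Stub 1 (XL; (A)-free research stub): the hexagonal end in GM conventions. First moves (landable):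
the exact dictionary at boundary mid-edges (yb-relay v4 `stub_gmHexDictionary`, Theorems/…YbRelayDefs),
exact restriction `law_{Ω'} = law_Ω(· | γ ⊂ Ω')`; research kernel: faces-vs-vertices boundary layer,
half-period shift and start relocation for the critical hexagonal law, no limit assumed. -/
theorem stub_hexToThirdYB : HexToThirdYB := by
  sorry

/-- Stub 2 (open-problem; HARDEST): law-level transport π/3 → π/2 (the prover chooses the square-tiling
endpoints). Reducible to SAWTrackTransport's stmt-16995 ∧ 16963 (`stub_thirdToSquareYB_of_trackTransport`). -/
theorem stub_thirdToSquareYB : ThirdToSquareYB := by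
  sorry

/-- Stub 3 (= item stmt-CriticalPhenomena-16966 of route `SAWTrackTransport`, verbatim; open-problem):
the off-family toll. -/
theorem stub_ybToUniform : SAWTrackTransport.YBtoUniform := by
  sorry

/-! ### The composition (sorry-free) -/

/-- **`HexToThirdYB → ThirdToSquareYB → YBtoUniform → (the crux body)`** — two-ε argument through the
GM `π/3` and `π/2` walks. [folklore] -/
theorem LatticeUniversality_of_stubs (h1 : HexToThirdYB) (h2 : ThirdToSquareYB)
    (h3 : SAWTrackTransport.YBtoUniform) :
    ∀ (D : DobrushinDomain) (a b : ℝ → Site 2) (a' b' : ℝ → HexVertex),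
      SAW.IsEndpointApprox D a b → SAW.IsEmbEndpointApprox hexGraph hexCenter D a' b' →
      ∀ f : BoundedContinuousFunction (CurveClass ℂ) ℝ,
        Tendsto (fun δ : ℝ => (∫ γ, f γ.curve ∂(SAW.law D.carrier δ (a δ) (b δ))) -
            ∫ γ, f γ.curve ∂(SAW.hexSAWLaw D.carrier δ (a' δ) (b' δ)))
          (𝓝[>] (0 : ℝ)) (𝓝 0) := by
  intro D a b a' b' hab hab' f
  obtain ⟨a₃, b₃, hab₃, hH⟩ := h1 D a' b' hab'
  obtain ⟨a₂, b₂, hab₂, hA⟩ := h2 D a₃ b₃ hab₃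
  have hZ := h3 D a b a₂ b₂ hab hab₂ f
  have h := (hZ.sub (hH f)).sub (hA f)
  simp only [sub_zero] at h
  exact h.congr fun δ => by ring

/-- **The crux from the line's registered stubs**, concluded BY NAME (route `SAWMassiveIsingTilt`,
item stmt-CriticalPhenomena-0807). -/
theorem LatticeUniversality_of : SAWMassiveIsingTilt.LatticeUniversality :=
  LatticeUniversality_of_stubs stub_hexToThirdYB stub_thirdToSquareYB stub_ybToUniform

/-- Sibling copies (identical bodies). -/
theorem latticeUniversality_residueField : SAWResidueField.LatticeUniversality := LatticeUniversality_of
theorem latticeUniversality_betheAnsatz : SAWBetheAnsatz.LatticeUniversality := LatticeUniversality_of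
theorem latticeUniversality_latticeVirasoro : SAWLatticeVirasoro.LatticeUniversality := LatticeUniversality_of
theorem latticeUniversality_tiltedExplorer : SAWTiltedExplorer.LatticeUniversality := LatticeUniversality_of
theorem latticeUniversality_turnDefect : SAWTurnDefect.LatticeUniversality := LatticeUniversality_of

/-! ### Sanity (sorry-free): the cut is dominated by `birth` and by SAWTrackTransport's items -/

/-- `birth`'s stubs 0+1 (π/3 endpoint approximations exist; ∀∀ convention bridge) give stub 1. [folklore] -/
theorem hexToThirdYB_of_birth
    (h0 : ∀ D : DobrushinDomain, ∃ a b : ℝ → MidEdge, IsYBEndpointApprox (fun (_ : ℤ) => Real.pi / 3) D a b)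
    (h1 : ∀ (D : DobrushinDomain) (a b : ℝ → HexVertex) (a' b' : ℝ → MidEdge),
      SAW.IsEmbEndpointApprox hexGraph hexCenter D a b →
      IsYBEndpointApprox (fun (_ : ℤ) => Real.pi / 3) D a' b' →
      ∀ f : BoundedContinuousFunction (CurveClass ℂ) ℝ,
        Tendsto (fun δ : ℝ => (∫ γ, f γ.curve ∂(SAW.hexSAWLaw D.carrier δ (a δ) (b δ))) -
            ∫ γ, f (γ.curve (fun (_ : ℤ) => Real.pi / 3) δ)
              ∂(ybLaw (fun (_ : ℤ) => Real.pi / 3) D.carrier δ 1 (a' δ) (b' δ)))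
          (𝓝[>] (0 : ℝ)) (𝓝 0)) :
    HexToThirdYB := fun D a b hab => by
  obtain ⟨a', b', hab'⟩ := h0 D
  exact ⟨a', b', hab', h1 D a b a' b' hab hab'⟩

/-- `birth`'s stub 2 (∀∀ angle transport) with the landed square-tiling endpoint approximations gives
stub 2. [folklore] -/
theorem thirdToSquareYB_of_birth
    (h2 : ∀ (D : DobrushinDomain) (a b a' b' : ℝ → MidEdge),
      IsYBEndpointApprox (fun (_ : ℤ) => Real.pi / 3) D a b →
      IsYBEndpointApprox (fun (_ : ℤ) => Real.pi / 2) D a' b' →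
      ∀ f : BoundedContinuousFunction (CurveClass ℂ) ℝ,
        Tendsto (fun δ : ℝ =>
            (∫ γ, f (γ.curve (fun (_ : ℤ) => Real.pi / 3) δ)
                ∂(ybLaw (fun (_ : ℤ) => Real.pi / 3) D.carrier δ 1 (a δ) (b δ))) -
              ∫ γ, f (γ.curve (fun (_ : ℤ) => Real.pi / 2) δ)
                ∂(ybLaw (fun (_ : ℤ) => Real.pi / 2) D.carrier δ 1 (a' δ) (b' δ)))
          (𝓝[>] (0 : ℝ)) (𝓝 0)) :
    ThirdToSquareYB := fun D a b hab => by
  obtain ⟨a', b', hab'⟩ := Cruxes.HexTransfer.Sketch.stub_compassEndpoints D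
  exact ⟨a', b', hab', h2 D a b a' b' hab hab'⟩

/-- Stub 2 from route SAWTrackTransport's items stmt-16995 (`YBLimitExists`) and stmt-16963
(`AngleUniversality`), through the landed reduction `angleTransport_of_trackTransport`. [folklore] -/
theorem stub_thirdToSquareYB_of_trackTransport (hL : SAWTrackTransport.YBLimitExists)
    (hU : SAWTrackTransport.AngleUniversality) : ThirdToSquareYB :=
  thirdToSquareYB_of_birth (Cruxes.HexTransfer.YbRelay.angleTransport_of_trackTransport hL hU)

end Summit.CriticalPhenomena.SAWScalingLimit.Cruxes.LatticeUniversality.Relay3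

end
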